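import Literature.MathematicalPhysics.QuantumFieldTheory.Balaban1983to89.B7Ineq149Pairing

/-!
# `Balaban1983to89.B7Prop5GeneralOperator` — T. Bałaban, *Averaging operations for lattice gauge theories*, Commun. Math. Phys. **98**
(1985) 17–51 [Balaban1985Averaging]: **PROPOSITION 5 (156) p. 42 AT A GENERAL REGULAR BACKGROUND IN OPERATOR FORM** — the composite
averaging `Q_j(U₀, ·)` as a Fréchet-differentiable map between FINITE sup-normed products of bond variables, its partial derivatives
identified with the single-bond differentials (137) of `B7Prop5General`, and the sup → sup bound `‖D Q_j(U₀, ·)‖ ≤ 2dLʲ(1 + θ(Lʲ/Lᵏ)² +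
C₃Lʲb)`, k-uniform, PROVED — the `U₀ ≠ 1` twin of `B7Prop5FlatOperator` (r20)

statement-level skeleton of published theorems with citation tags; proofs where landed; nothing here is a claim about the Yang–Mills mass gap

PDF held: `paper:balaban1985-cmp98-averaging` (journal page = PDF page + 16); pp. 38–42 [PDF 22–26] read from the materialised text
layer `~/.lit/texts/paper-balaban1985-cmp98-averaging/p0022.txt`–`p0026.txt`.

CITATION HEADER / WHAT IS REPRODUCED.  SKELETON row **B7.Prop5** — cell `lit-balaban`, seat p06 gen 3 = unit `lit-balaban-p06`; owner
r04, referee ref-4.  p. 42, verbatim: *"Proposition 5. The functional derivative of Q_k(U₀, ηA) is a bounded function for α₀, α₁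
sufficiently small, and we have the bounds |(δ/δA_b)Q_k(U₀, ηA, c)| ≦ 1 + 2C′₁α₀ + C₃|A| < 1 + 2C′₁α₀ + C₃α₁, (156)"*; p. 39: *"We
would like to prove that the functional derivative of Q_k(U₀, ηA) is bounded by a constant independent of η"*, (138) *"the
functional derivative coincides with partial derivatives (gradient) of F(A) multiplied by η^{−d}"*, (141) *"(Q″_kA)_c =
Σ_{b⊂B^k(c₋)∪B^k(c₊)} η^dA_b"*; Prop. 4 p. 38: *"Q_k(U₀, ηA, c) … is an analytic function of the variables A_b, b ⊂ B^k(c₋)∪B^k(c₊)"*.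
`B7Prop5General.prop5_general_156` (p06 gen 3) is (156) PER BOND at a general background; `B7Prop5FlatOperator` (r20 gen 3) is (156)
at `U₀ = 1` in OPERATOR form on `𝔸^S → 𝔸^T` — the shape the consumers in [Balaban1987RG1] use ((3.49) p. 279 via
`B12QPrime348.ineq349_lam330`'s hypothesis `‖fderiv ℝ Q y‖ ≤ C·Lʲ`; (4.17) p. 285).  THIS FILE is the operator form AT A GENERAL
REGULAR BACKGROUND: the passage is (138) summed over the bonds of (141), row by row, exactly as in `B7Prop5FlatOperator` §5, with
the per-bond sizes of `prop5_general_156`/`prop5_general_157`/`prop5_general_147` and the count `Σ_s kerQdd(c, s) ≤ 2d` of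
`B7Ineq149Pairing.sum_kerQdd_mul_norm_le`.

DICTIONARY (as in `B7Prop5General` / `B7Prop5FlatOperator`: `B`-variables `B = ηA` on the unit lattice `ℤᵈ`, `η = L^{−k}`, `sup_b
‖B_b‖ ≤ b`, `Lᵏb` plays `α₁`; a bond of the `j`-th lattice is `c = (z, κ)`, its box `Bʲ(c₋) ∪ Bʲ(c₊)` is `[loK L j z, bondHiK L j z
κ]`).  `S` = a finite set of fine bonds (the variables; all other bond variables frozen at `0`, `B7Prop3Flat.insCfg`), `T` = a finite
set of bonds of the `j`-th lattice; **`covAvgMap L U₀ S T j a c = logCovIter L U₀ (insCfg S a) j c`** = `Q_j(U₀, B)(c)` as a function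
`𝔸^S → 𝔸^T` (at `U₀ = 1`: `B7Prop5FlatOperator.avgMap`, `covAvgMap_one`); the partial derivative in the variable `s ∈ S` applied to
`X ∈ 𝔸` = `fderiv ℂ (covAvgMap …) a (Pi.single s X)`; `θ = thetaGen d L α₀` (print's `2C′₁α₀`), `C₃ = C3Gen d L`; the per-bond
size (156) in `B`-variables = `((1 + θ(Lʲ/Lᵏ)²)·Lʲ + C₃(Lʲ)²b)·L^{−jd}` (`= (1 + θ + C₃|A|)·η^d·Lᵏ` at `j = k`, the extra `Lᵏ` being
the un-normalisation `B = ηA` of the ARGUMENT — the `Lʲ` of (150) and of [Balaban1987RG1] (3.49), cf. `prop5_general_156_printed`).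

WHAT THIS FILE PROVES (kernel, 0 sorry, standard axioms; one object definition `covAvgMap`, no `def … : Prop`), for `L ≥ 2`, an
`AvgClosed` structure group `G ∋ U₀`, the regime of `B7Prop5General` (`pdev U₀ < α₀L^{−2k}`, `hsmall`, `hc₃`, `h145`, `h155`),
finite `S`, `T`, every `j ≤ k`, and `sup_s ‖a_s‖ ≤ b`, `b > 0`:
* §1 `covAvgMap`, `covAvgMap_apply`, `covAvgMap_one` (`= B7Prop5FlatOperator.avgMap` at `U₀ = 1`).
* §2 `analyticAt_covAvgMap_apply`, `differentiableAt_covAvgMap` — Prop. 4's analyticity clause at a general background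
  (`B7Prop6GeneralAnalytic.prop4_general_analyticAt`, r04, BY NAME).
* §3 **`fderiv_covAvgMap_single`**: `∂_s Q_j(U₀, ·)(c)·X = dC_j(B; X·δ_s)(c) + LʲηQ_j(U₀)(X·δ_s)(c)` (`prop5_general_156`);
  **`norm_fderiv_covAvgMap_single_le`**: `≤ ((1 + θ(Lʲ/Lᵏ)²)Lʲ + C₃(Lʲ)²b)·kerQdd(c, s)·‖X‖` ((156) per bond with locality:
  `fderiv_covAvgMap_single_eq_zero`, `= 0` unless `s ⊂ Bʲ(c₋) ∪ Bʲ(c₊)`, from `prop5_general_157`/`prop5_general_147`).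
* §4 **`opNorm_fderiv_covAvgMap_le`**: `‖D Q_j(U₀, ·)(B)‖_{sup→sup} ≤ 2dLʲ(1 + θ(Lʲ/Lᵏ)² + C₃Lʲb)` on `𝔸^S → 𝔸^T`, and the real-scalar
  forms `differentiableAt_covAvgMap_real`, `fderiv_real_covAvgMap_apply`, **`opNorm_fderiv_real_covAvgMap_le`** (the hypothesis
  shape `‖fderiv ℝ Q y‖ ≤ C·Lʲ` of `B12QPrime348.ineq349_lam330`, `C = 2d(1 + θ + C₃Lᵏb)` at `j = k`), `fderiv_real_covAvgMap_single_bound`.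

DIVERGENCES / NOT PROVED.  As `B7Prop5General` (explicit, non-optimal `θ`, `C₃`; `ℤᵈ`, corner blocks; `U1`/`AvgClosed`); the bound is
in `B`-variables (print's (156) is per bond in `A`-variables with the `η^d` of (138): the operator form in `A`-variables would read `≤
2d(1 + 2C′₁α₀ + C₃α₁)`); the count `2d·L^{jd}` is that of the box `[Lʲz, Lʲz + (Lʲ − 1)𝟙 + Lʲe_κ]` (`B7Prop5FlatOperator.card_bondsIn_le`);
print states (156) per bond, not an operator norm.
-/

noncomputable section

open scoped BigOperators
open NormedSpace Finset Metric

namespace Literature.MathematicalPhysics.QuantumFieldTheory.Balaban1983to89.B7Prop5GeneralOperator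

open B7Prop1Explicit B7Prop1Local B7Prop2Explicit B7Prop3Flat B7Prop4Flat B7Eq92Concrete B7Prop3GeneralLinear
  B7Prop4GeneralLevels B7Ineq148 B7Prop5GeneralOperators B7Prop5GeneralLinear B7Prop5GeneralInduction B7Prop5GeneralLevels
  B7Prop5General B7Ineq149Pairing
open B7Prop5Flat (BondIn bump)
open B7Prop5FlatOperator (avgMap insCfg_line norm_insCfg_le_of_le)
open B7Prop6GeneralAnalytic (prop4_general_analyticAt)

-- `Site` alone would resolve to the torus sites of `Setup.lean`; re-export the `ℤ^d` sites of `B7Prop1Explicit`.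
export B7Prop1Explicit (Site)

variable {d : ℕ}

/-- `θ ≥ 0` for `α₀ ≥ 0`. [folklore] -/
private theorem thetaGen_nonneg (d L : ℕ) {α₀ : ℝ} (hα : 0 ≤ α₀) : 0 ≤ thetaGen d L α₀ := by
  unfold thetaGen; positivity

/-- `C₃ ≥ 0`. [folklore] -/
private theorem C3Gen_nonneg (d L : ℕ) : 0 ≤ C3Gen d L := by
  unfold C3Gen C1ppGen; positivity

section Objects

variable {𝔸 : Type*} [NormedRing 𝔸] [NormedAlgebra ℂ 𝔸] [CompleteSpace 𝔸]

/-! ## §1 The composite averaging at a general background on finite products -/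

/-- **`Q_j(U₀, B)` as a map `𝔸^S → 𝔸^T`**: the variables are the bond variables `B_s`, `s ∈ S` (the others frozen at `0`, `insCfg`),
the values are the bond variables `Q_j(U₀, B)(c)`, `c ∈ T`, of the `j`-th lattice (`logCovIter`, the composite (127) at the background
`U₀`). [cite: Balaban1985Averaging, (127) p.37, Prop. 4 p.38] -/
def covAvgMap (L : ℕ) (U₀ : Site d → Fin d → 𝔸ˣ) (S T : Finset (Site d × Fin d)) (j : ℕ) (a : S → 𝔸) : T → 𝔸 :=
  fun c => logCovIter L U₀ (insCfg S a) j c.1.1 c.1.2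

/-- Unfolding of `covAvgMap`. [cite: Balaban1985Averaging, (127) p.37] -/
@[simp] theorem covAvgMap_apply (L : ℕ) (U₀ : Site d → Fin d → 𝔸ˣ) (S T : Finset (Site d × Fin d)) (j : ℕ) (a : S → 𝔸)
    (c : T) : covAvgMap L U₀ S T j a c = logCovIter L U₀ (insCfg S a) j c.1.1 c.1.2 := rfl

/-- At the flat background `U₀ = 1` the map is `B7Prop5FlatOperator.avgMap` (`Q_j(1, ·)`, `B7Prop4GeneralLevels.logCovIter_one_left`).
[cite: Balaban1985Averaging, (127) p.37] -/
theorem covAvgMap_one (L : ℕ) (S T : Finset (Site d × Fin d)) (j : ℕ) :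
    covAvgMap L (1 : Site d → Fin d → 𝔸ˣ) S T j = avgMap L S T j := by
  funext a c
  rw [covAvgMap_apply, B7Prop5FlatOperator.avgMap_apply, logCovIter_one_left]

end Objects

section Regime

variable {𝔸 : Type*} [NormedRing 𝔸] [NormedAlgebra ℂ 𝔸] [CompleteSpace 𝔸] [NormOneClass 𝔸]

variable (L : ℕ) (hL : 2 ≤ L) {G : Subgroup 𝔸ˣ} (hG : AvgClosed d L G) (k : ℕ)
  (U₀ : Site d → Fin d → 𝔸ˣ) (hU₀ : ∀ x κ, U₀ x κ ∈ G) {α₀ : ℝ} (hα : 0 < α₀)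
  (hα3 : C0 d * α₀ ≤ 1 / 3) (hα4 : 4 * α₀ ≤ c2' d L) (h52 : pdev U₀ < α₀ * (((L : ℝ) ^ k)⁻¹) ^ 2)
  {b : ℝ} (hb : 0 < b)
  (hsmall : Real.exp (4 * (800 * ((d : ℝ) + 1) ^ 2 * ((d : ℝ) + 4)) * α₀)
    * (1 + 8 * (131072 * ((d : ℝ) + 1) ^ 2) * ((L : ℝ) ^ k * b)) ≤ 2)
  (hc₃ : 4 * ((L : ℝ) ^ k * b) < c3 d L)
  (h145 : 8 * d * thetaGen d L α₀ * (L : ℝ)⁻¹ ^ 4 ≤ 1)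
  (h155 : (2 * (L : ℝ) - 1) * (L : ℝ)⁻¹ ^ 2 + 2 * d * thetaGen d L α₀ * (L : ℝ)⁻¹ ^ 3
    + 1 / 8 * (1 + 2 * d * thetaGen d L α₀ * (L : ℝ)⁻¹ ^ 2 + 2 * d * C3Gen d L * ((L : ℝ) ^ k * b)) * (L : ℝ)⁻¹ ^ 2 ≤ 1)
  (S T : Finset (Site d × Fin d)) {a : S → 𝔸} (ha : ∀ s, ‖a s‖ ≤ b)

/-! ## §2 Analyticity and differentiability (Prop. 4 at a general background, BY NAME) -/

include hL hG hU₀ hα hα3 hα4 h52 hb hsmall hc₃ ha in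
/-- **Prop. 4's analyticity clause at a general background, transported**: under `sup_s ‖a_s‖ ≤ b` and the regime, every component
`a′ ↦ Q_j(U₀, ins a′)(c)` of `covAvgMap`, `j ≤ k`, is analytic at `a` (`B7Prop6GeneralAnalytic.prop4_general_analyticAt`, BY NAME, with
the bondwise analytic parametrisation `insCfg`). [cite: Balaban1985Averaging, Prop. 4 p.38] -/
theorem analyticAt_covAvgMap_apply {j : ℕ} (hj : j ≤ k) (c : T) :
    AnalyticAt ℂ (fun a' : S → 𝔸 => covAvgMap L U₀ S T j a' c) a := by
  have hLkb : 0 ≤ (L : ℝ) ^ k * b := by positivity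
  have hc₃' : 2 * ((L : ℝ) ^ k * b) ≤ c3 d L := by linarith
  exact prop4_general_analyticAt L hL hG k U₀ hU₀ hα hα3 hα4 h52 (fun a' : S → 𝔸 => insCfg S a')
    (fun x κ' => analyticAt_insCfg S x κ' a) hb.le (fun x κ' => norm_insCfg_le_of_le hb.le ha x κ') hsmall hc₃' j hj c.1.1 c.1.2

include hL hG hU₀ hα hα3 hα4 h52 hb hsmall hc₃ ha in
/-- `covAvgMap` is (complex) Fréchet differentiable at every point of the closed polydisc `sup_s ‖a_s‖ ≤ b`, `j ≤ k`.
[cite: Balaban1985Averaging, Prop. 4 p.38, (137)–(138) p.39] -/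
theorem differentiableAt_covAvgMap {j : ℕ} (hj : j ≤ k) : DifferentiableAt ℂ (covAvgMap L U₀ S T j) a :=
  differentiableAt_pi.2 fun c =>
    (analyticAt_covAvgMap_apply L hL hG k U₀ hU₀ hα hα3 hα4 h52 hb hsmall hc₃ S T ha hj c).differentiableAt

/-! ## §3 The partial derivatives are the single-bond differentials of `B7Prop5General`: (156) per bond, and locality -/

include hL hG hU₀ hα hα3 hα4 h52 hb hsmall hc₃ h145 h155 ha in
/-- **`∂_s Q_j(U₀, ·)(c)·X = dC_j(B; X·δ_s)(c) + LʲηQ_j(U₀)(X·δ_s)(c)`**: the Fréchet partial derivative of `covAvgMap` in the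
variable `s` applied to `X` is the single-bond differential (137) of `Q_j(U₀, ·)(c) = C_j + LʲηQ_j(U₀)` at `B = ins a` in the
direction `bump s X` (`prop5_general_156`: the line derivative; uniqueness of the derivative along the inserted complex line `ins(a
+ tX·δ_s) = B + t·bump_s X`, `B7Prop5FlatOperator.insCfg_line`). [cite: Balaban1985Averaging, (137)–(138) p.39, (156) p.42, (134) p.38] -/
theorem fderiv_covAvgMap_single {j : ℕ} (hj : j ≤ k) (s : S) (X : 𝔸) (c : T) :
    fderiv ℂ (covAvgMap L U₀ S T j) a (Pi.single s X) c =
      dCov L U₀ (insCfg S a) (bump s.1.1 s.1.2 X) j c.1.1 c.1.2 + linCovIter L U₀ (bump s.1.1 s.1.2 X) j c.1.1 c.1.2 := by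
  have hD := differentiableAt_covAvgMap L hL hG k U₀ hU₀ hα hα3 hα4 h52 hb hsmall hc₃ S T ha hj
  have hB : ∀ x κ', ‖insCfg S a x κ'‖ ≤ b := fun x κ' => norm_insCfg_le_of_le hb.le ha x κ'
  -- the derivative of `covAvgMap` along the line `a + t·X·δ_s`, component `c`
  have hline : HasDerivAt (fun t : ℂ => a + t • (Pi.single s X : S → 𝔸)) (Pi.single s X) 0 := by
    simpa using ((hasDerivAt_id (0 : ℂ)).smul_const (Pi.single s X : S → 𝔸)).const_add a
  have hD' : HasFDerivAt (covAvgMap L U₀ S T j) (fderiv ℂ (covAvgMap L U₀ S T j) a)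
      (a + (0 : ℂ) • (Pi.single s X : S → 𝔸)) := by
    rw [zero_smul, add_zero]; exact hD.hasFDerivAt
  have h1 : HasDerivAt (fun t : ℂ => covAvgMap L U₀ S T j (a + t • (Pi.single s X : S → 𝔸)))
      (fderiv ℂ (covAvgMap L U₀ S T j) a (Pi.single s X)) 0 := by
    have h := hD'.comp_hasDerivAt (0 : ℂ) hline
    simpa only [Function.comp_def] using h
  have h1c : HasDerivAt (fun t : ℂ => covAvgMap L U₀ S T j (a + t • (Pi.single s X : S → 𝔸)) c)
      (fderiv ℂ (covAvgMap L U₀ S T j) a (Pi.single s X) c) 0 := (hasDerivAt_pi.1 h1) c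
  -- the single-bond line derivative of `Q_j(U₀, ·)(c)` at `B = ins a` in the direction `bump s X` (`prop5_general_156`)
  obtain ⟨h2, -⟩ := prop5_general_156 L hL hG k U₀ hU₀ hα hα3 hα4 h52 (insCfg S a) hb.le hB hsmall hc₃ h145 h155
    s.1.1 s.1.2 X hj c.1.1 c.1.2
  have h2' : HasDerivAt (fun t : ℂ => logCovIter L U₀ (insCfg S a + t • bump s.1.1 s.1.2 X) j c.1.1 c.1.2)
      (dCov L U₀ (insCfg S a) (bump s.1.1 s.1.2 X) j c.1.1 c.1.2 + linCovIter L U₀ (bump s.1.1 s.1.2 X) j c.1.1 c.1.2) 0 := h2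
  have h2'' : HasDerivAt (fun t : ℂ => covAvgMap L U₀ S T j (a + t • (Pi.single s X : S → 𝔸)) c)
      (dCov L U₀ (insCfg S a) (bump s.1.1 s.1.2 X) j c.1.1 c.1.2 + linCovIter L U₀ (bump s.1.1 s.1.2 X) j c.1.1 c.1.2) 0 := by
    refine h2'.congr_of_eventuallyEq (Filter.Eventually.of_forall fun t => ?_)
    simp only [covAvgMap_apply, insCfg_line]
  exact h1c.unique h2''

include hL hG hU₀ hα hα3 hα4 h52 hb hsmall hc₃ h145 h155 ha in
/-- **(156) AT A GENERAL BACKGROUND, PER BOND, WITH LOCALITY, for the partial derivatives of `covAvgMap`**: `‖∂_s Q_j(U₀, ·)(c)·X‖ ≤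
((1 + θ(Lʲ/Lᵏ)²)·Lʲ + C₃(Lʲ)²b)·kerQdd(c, s)·‖X‖` — «|(δ/δA_b)Q_k(U₀, ηA, c)| ≦ 1 + 2C′₁α₀ + C₃|A|» times the `η^d` of (138) and the
`Lʲ` of the `B`-variables on the box `s ⊂ Bʲ(c₋) ∪ Bʲ(c₊)` (`kerQdd(c, s) = L^{−jd}`), and `0` off the box (`prop5_general_157`,
`prop5_general_147`, BY NAME). [cite: Balaban1985Averaging, Prop. 5 (156) p.42, (138) p.39, (141) p.39] -/
theorem norm_fderiv_covAvgMap_single_le {j : ℕ} (hj : j ≤ k) (s : S) (X : 𝔸) (c : T) :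
    ‖fderiv ℂ (covAvgMap L U₀ S T j) a (Pi.single s X) c‖ ≤
      ((1 + thetaGen d L α₀ * ((L : ℝ) ^ j * ((L : ℝ) ^ k)⁻¹) ^ 2) * (L : ℝ) ^ j + C3Gen d L * ((L : ℝ) ^ j) ^ 2 * b)
        * kerQdd L j c.1.1 c.1.2 s.1.1 s.1.2 * ‖X‖ := by
  have hB : ∀ x κ', ‖insCfg S a x κ'‖ ≤ b := fun x κ' => norm_insCfg_le_of_le hb.le ha x κ'
  rw [fderiv_covAvgMap_single L hL hG k U₀ hU₀ hα hα3 hα4 h52 hb hsmall hc₃ h145 h155 S T ha hj s X c]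
  obtain ⟨-, hC, hCloc⟩ := prop5_general_157 L hL hG k U₀ hU₀ hα hα3 hα4 h52 (insCfg S a) hb.le hB hsmall hc₃ h145 h155
    s.1.1 s.1.2 X hj c.1.1 c.1.2
  obtain ⟨hQ, hQloc⟩ := prop5_general_147 L hL hG k U₀ hU₀ hα hα3 hα4 h52 h145 s.1.1 s.1.2 X hj c.1.1 c.1.2
  by_cases hin : BondIn (loK L j c.1.1) (bondHiK L j c.1.1 c.1.2) s.1.1 s.1.2
  · rw [kerQdd_of_bondIn hin]
    refine (norm_add_le _ _).trans ?_
    have hsum := add_le_add hC hQ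
    refine hsum.trans (le_of_eq ?_)
    ring
  · rw [hCloc hin, hQloc hin, add_zero, norm_zero, kerQdd_of_not_bondIn hin, mul_zero, zero_mul]

include hL hG hU₀ hα hα3 hα4 h52 hb hsmall hc₃ h145 h155 ha in
/-- **LOCALITY of the partial derivatives** (Prop. 4: `Q_k(U₀, ηA, c)` «is an analytic function of the variables A_b, b ⊂
B^k(c₋)∪B^k(c₊)»; (141)): `∂_s Q_j(U₀, ·)(c) = 0` unless the bond `s` lies in the box `[loK L j z, bondHiK L j z κ]` of `c = (z, κ)`.
[cite: Balaban1985Averaging, Prop. 4 p.38, (141) p.39, (157) p.42] -/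
theorem fderiv_covAvgMap_single_eq_zero {j : ℕ} (hj : j ≤ k) (s : S) (X : 𝔸) (c : T)
    (hnot : ¬ BondIn (loK L j c.1.1) (bondHiK L j c.1.1 c.1.2) s.1.1 s.1.2) :
    fderiv ℂ (covAvgMap L U₀ S T j) a (Pi.single s X) c = 0 := by
  have h := norm_fderiv_covAvgMap_single_le L hL hG k U₀ hU₀ hα hα3 hα4 h52 hb hsmall hc₃ h145 h155 S T ha hj s X c
  rw [kerQdd_of_not_bondIn hnot, mul_zero, zero_mul] at h
  exact norm_le_zero_iff.1 h

/-! ## §4 The sup → sup operator bound on `D Q_j(U₀, ·)` (Proposition 5 at a general background, operator form) -/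

include hL hG hU₀ hα hα3 hα4 h52 hb hsmall hc₃ h145 h155 ha in
/-- **PROPOSITION 5 AT A GENERAL REGULAR BACKGROUND, OPERATOR FORM, k-UNIFORM**: on the finite products `𝔸^S → 𝔸^T` (sup norms), for
every `j ≤ k` and `sup_s ‖a_s‖ ≤ b` in the regime, the Fréchet derivative of `B ↦ Q_j(U₀, B)` at `B = ins a` has operator norm `≤
2dLʲ(1 + θ(Lʲ/Lᵏ)² + C₃Lʲb)` — the per-bond bound (156) summed over the `≤ 2d·L^{jd}` bonds of `Bʲ(c₋) ∪ Bʲ(c₊)` with the weight `η^d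
= L^{−jd}` of (138)/(141), row by row (`f(v) = Σ_s f(v_s·δ_s)`, `B7Ineq149Pairing.sum_kerQdd_mul_norm_le`).  In `A`-variables (`B =
ηA`, `j = k`) this is «the functional derivative of Q_k(U₀, ηA) is bounded by a constant independent of η» (p. 39) in operator form,
`≤ 2d(1 + 2C′₁α₀ + C₃α₁)`; the factor `Lʲ` is the scale of the argument ((150); [Balaban1987RG1] (3.49)); at `U₀ = 1`, `θ = 0`:
`B7Prop5FlatOperator.opNorm_fderiv_avgMap_le`. [cite: Balaban1985Averaging, Prop. 5 (156) p.42, (138) p.39, (141) p.39, (150) p.40] -/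
theorem opNorm_fderiv_covAvgMap_le {j : ℕ} (hj : j ≤ k) :
    ‖fderiv ℂ (covAvgMap L U₀ S T j) a‖ ≤
      2 * d * (L : ℝ) ^ j
        * (1 + thetaGen d L α₀ * ((L : ℝ) ^ j * ((L : ℝ) ^ k)⁻¹) ^ 2 + C3Gen d L * ((L : ℝ) ^ j * b)) := by
  classical
  have hL1 : 1 ≤ L := le_trans (by norm_num) hL
  have hθ := thetaGen_nonneg d L hα.le
  have hC := C3Gen_nonneg d L
  set f := fderiv ℂ (covAvgMap L U₀ S T j) a with hf
  set m : ℝ := (1 + thetaGen d L α₀ * ((L : ℝ) ^ j * ((L : ℝ) ^ k)⁻¹) ^ 2) * (L : ℝ) ^ j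
    + C3Gen d L * ((L : ℝ) ^ j) ^ 2 * b with hm
  have hm0 : 0 ≤ m := by positivity
  have hK0 : 0 ≤ 2 * d * (L : ℝ) ^ j
      * (1 + thetaGen d L α₀ * ((L : ℝ) ^ j * ((L : ℝ) ^ k)⁻¹) ^ 2 + C3Gen d L * ((L : ℝ) ^ j * b)) := by positivity
  refine ContinuousLinearMap.opNorm_le_bound f hK0 fun v => ?_
  refine (pi_norm_le_iff_of_nonneg (by positivity)).mpr fun c => ?_
  have hdec : f v = ∑ s, f (Pi.single s (v s)) := by
    conv_lhs => rw [← Finset.univ_sum_single v]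
    rw [map_sum]
  rw [hdec, Finset.sum_apply]
  -- per-bond bounds, with locality built into `kerQdd`
  have hM : ∀ s : S, ‖f (Pi.single s (v s)) c‖ ≤ m * (kerQdd L j c.1.1 c.1.2 s.1.1 s.1.2 * ‖v s‖) := fun s => by
    rw [hf, ← mul_assoc]
    exact norm_fderiv_covAvgMap_single_le L hL hG k U₀ hU₀ hα hα3 hα4 h52 hb hsmall hc₃ h145 h155 S T ha hj s (v s) c
  calc ‖∑ s, f (Pi.single s (v s)) c‖ ≤ ∑ s, ‖f (Pi.single s (v s)) c‖ := norm_sum_le _ _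
    _ ≤ ∑ s : S, m * (kerQdd L j c.1.1 c.1.2 s.1.1 s.1.2 * ‖v s‖) := sum_le_sum fun s _ => hM s
    _ = m * ∑ s : S, kerQdd L j c.1.1 c.1.2 s.1.1 s.1.2 * ‖v s‖ := by rw [Finset.mul_sum]
    _ ≤ m * (2 * d * ‖v‖) := mul_le_mul_of_nonneg_left (sum_kerQdd_mul_norm_le S L hL1 j c.1.1 c.1.2 v) hm0
    _ = 2 * d * (L : ℝ) ^ j
        * (1 + thetaGen d L α₀ * ((L : ℝ) ^ j * ((L : ℝ) ^ k)⁻¹) ^ 2 + C3Gen d L * ((L : ℝ) ^ j * b)) * ‖v‖ := by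
        rw [hm]; ring

/-! ### Real-scalar forms (the shape differentiated over `ℝ` in [Balaban1987RG1] (3.48)–(3.49)) -/

include hL hG hU₀ hα hα3 hα4 h52 hb hsmall hc₃ ha in
/-- `covAvgMap` is real-differentiable on the polydisc (restriction of scalars). [cite: Balaban1985Averaging, Prop. 4 p.38] -/
theorem differentiableAt_covAvgMap_real {j : ℕ} (hj : j ≤ k) : DifferentiableAt ℝ (covAvgMap L U₀ S T j) a :=
  (differentiableAt_covAvgMap L hL hG k U₀ hU₀ hα hα3 hα4 h52 hb hsmall hc₃ S T ha hj).restrictScalars ℝ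

include hL hG hU₀ hα hα3 hα4 h52 hb hsmall hc₃ ha in
/-- The real Fréchet derivative of `covAvgMap` is the complex one with scalars restricted: same values.
[cite: Balaban1985Averaging, (137)–(138) p.39] -/
theorem fderiv_real_covAvgMap_apply {j : ℕ} (hj : j ≤ k) (v : S → 𝔸) :
    fderiv ℝ (covAvgMap L U₀ S T j) a v = fderiv ℂ (covAvgMap L U₀ S T j) a v := by
  rw [((differentiableAt_covAvgMap L hL hG k U₀ hU₀ hα hα3 hα4 h52 hb hsmall hc₃ S T ha hj).hasFDerivAt.restrictScalars ℝ).fderiv]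
  rfl

include hL hG hU₀ hα hα3 hα4 h52 hb hsmall hc₃ h145 h155 ha in
/-- **PROPOSITION 5 AT A GENERAL BACKGROUND, OPERATOR FORM over `ℝ`**: `‖D_ℝ Q_j(U₀, ·)(ins a)‖ ≤ 2dLʲ(1 + θ(Lʲ/Lᵏ)² + C₃Lʲb)` — the
hypothesis shape `‖fderiv ℝ Q y‖ ≤ C·Lʲ` of `B12QPrime348.ineq349_lam330` for `Q = covAvgMap L U₀ S T j`, with `C = 2d(1 + θ +
C₃Lᵏb)` k-uniformly. [cite: Balaban1985Averaging, Prop. 5 (156) p.42, (150) p.40] -/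
theorem opNorm_fderiv_real_covAvgMap_le {j : ℕ} (hj : j ≤ k) :
    ‖fderiv ℝ (covAvgMap L U₀ S T j) a‖ ≤
      2 * d * (L : ℝ) ^ j
        * (1 + thetaGen d L α₀ * ((L : ℝ) ^ j * ((L : ℝ) ^ k)⁻¹) ^ 2 + C3Gen d L * ((L : ℝ) ^ j * b)) := by
  rw [((differentiableAt_covAvgMap L hL hG k U₀ hU₀ hα hα3 hα4 h52 hb hsmall hc₃ S T ha hj).hasFDerivAt.restrictScalars ℝ).fderiv,
    ContinuousLinearMap.norm_restrictScalars]
  exact opNorm_fderiv_covAvgMap_le L hL hG k U₀ hU₀ hα hα3 hα4 h52 hb hsmall hc₃ h145 h155 S T ha hj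

include hL hG hU₀ hα hα3 hα4 h52 hb hsmall hc₃ h145 h155 ha in
/-- **The per-bond data over `ℝ`** (the shape of `B7Prop5FlatOperator.fderiv_real_avgMap_single_bound`): on the polydisc the real
partial derivative in the variable `s` satisfies `‖∂_s(c)·X‖ ≤ ((1 + θ(Lʲ/Lᵏ)²)Lʲ + C₃(Lʲ)²b)·kerQdd(c, s)·‖X‖` (so it vanishes unless `s
⊂ box(c)`). [cite: Balaban1985Averaging, Prop. 5 (156) p.42, (141) p.39] -/
theorem fderiv_real_covAvgMap_single_bound {j : ℕ} (hj : j ≤ k) (s : S) (X : 𝔸) (c : T) :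
    ‖fderiv ℝ (covAvgMap L U₀ S T j) a (Pi.single s X) c‖ ≤
      ((1 + thetaGen d L α₀ * ((L : ℝ) ^ j * ((L : ℝ) ^ k)⁻¹) ^ 2) * (L : ℝ) ^ j + C3Gen d L * ((L : ℝ) ^ j) ^ 2 * b)
        * kerQdd L j c.1.1 c.1.2 s.1.1 s.1.2 * ‖X‖ ∧
      (¬ BondIn (loK L j c.1.1) (bondHiK L j c.1.1 c.1.2) s.1.1 s.1.2 →
        fderiv ℝ (covAvgMap L U₀ S T j) a (Pi.single s X) c = 0) := by
  rw [fderiv_real_covAvgMap_apply L hL hG k U₀ hU₀ hα hα3 hα4 h52 hb hsmall hc₃ S T ha hj]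
  exact ⟨norm_fderiv_covAvgMap_single_le L hL hG k U₀ hU₀ hα hα3 hα4 h52 hb hsmall hc₃ h145 h155 S T ha hj s X c,
    fun hnot => fderiv_covAvgMap_single_eq_zero L hL hG k U₀ hU₀ hα hα3 hα4 h52 hb hsmall hc₃ h145 h155 S T ha hj s X c hnot⟩

end Regime

end Literature.MathematicalPhysics.QuantumFieldTheory.Balaban1983to89.B7Prop5GeneralOperator

end
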